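import Literature.AnabelianGeometry.AbsoluteAnabelian.UnitKummerNaturalityTCGIntrinsic
import Literature.AnabelianGeometry.AbsoluteAnabelian.MonoidKummerLimitGroup
import HarnessLib

/-!
# [AbsTopIII] Prop 3.3 (i): the COLIMIT unit Kummer maps `M → lim→_J H¹(J, μ_Ẑ(M))` of the model pairs —
# level-independence and naturality along general morphisms, packaged at compatible levels

S. Mochizuki, *Topics in absolute anabelian geometry III*, §3, Prop. 3.3 (i) p. 73 (bib key `MochizukiAbsTopIII2015`):
the Kummer maps "`M^H → H¹(H, μ_Ẑ(M))`; `M → lim→_J H¹(J, μ_Ẑ(M))`" are "functorial [i.e., relative to `C^MLF_T`, in the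
evident sense]".

abc-iut cell, layer L4, row «Prop33i-NATURALITY», piece «COLIMIT-PACKAGING» (abc-iut-L4-lead RULING #5w (3); seat
abc-iut-w4-d009 gen 4).  PROOF-ONLY (0 `def`s), over abc-iut-L4-t2's `UnitKummerModel.lean` (the MODEL unit Kummer theories
`unitKummerTheoryTLG/TCG`, whose field `kummerLim m := ⟦(Stab m, κ_{Stab m}(m))⟧` lives in the BARE quotient
`ContCohomologyData.H1Lim = (Σ J, H¹(J, ·)) / eventual agreement`), the group-structured colimit
`ContCohomologyData.H1LimGrp` / `ofGrp` / `toGrp` of `MonoidKummerLimitGroup.lean`, and the finite-level naturality of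
`UnitKummerNaturalityCovariant.lean` (p429893).  WHAT PROOF-ONLY CAN SAY: the interface `UnitKummerTheory` carries NO law
on `kummerLim`, and `ContCohomologyData` carries no functoriality along group homomorphisms — a common target colimit
`lim→_{J₁} H¹(J₁, res_{φ_Π} Λ(M₂))` would be NEW DATA.  So the packaging is stated at REPRESENTATIVES:

* §1 `ModelMLFGaloisData.unitKummerTheoryTLG_kummerLim_eq_mk` / `…TCG…` — the missing `kummerLim_spec` law for the
  model unit theories: `kummerLim m = ⟦(H, κ_H(m))⟧` for EVERY open `H` fixing `m` (level-independence in the quotient,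
  via abc-iut-L2-t3's `resH1_kummerClass`), and `…_toGrp_kummerLim` — its image in the group-structured direct limit is
  `ofGrp H (κ_H m)`;
* §2 `GaloisMonoidPair.Hom.tlg_kummerLim_natural` / `tcg_kummerLim_natural` — for ANY Def. 3.1 (ii) morphism `φ` of the
  model `TLG`- (resp. `TCG`-) pairs and ANY compatible open levels `H₁ ≤ Π₁`, `H₂ ≤ Π₂` (`φ_Π(H₁) ≤ H₂`, `m₁ ∈ M₁^{H₁}`,
  `φ_M m₁ ∈ M₂^{H₂}`; such levels always exist: `exists_compatible_levels`): the colimit classes `kummerLim₂(φ_M m₁)` and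
  `kummerLim₁(m₁)` are represented at `(H₂, H₁)` by classes whose pull-back and push-forward along `(φ_Π, φ_M)` AGREE in
  `H¹(H₁, res_{φ_Π} Λ(M₂))` — naturality of the colimit Kummer maps «at every pair of compatible levels», which is all
  the bare quotient can express.

HONEST FRAMING: OUR kernel statements about the model objects of a refereed 2015 paper (model level); nothing here
bears on [IUTchIII] Cor. 3.12.
-/

noncomputable section

open scoped nonZeroDivisors

namespace Literature.AnabelianGeometry.AbsoluteAnabelian

open Literature.AnabelianGeometry.EtaleTheta (EquivariantMorphism kummerClass invariants)

/-! ## §1 Level-independence of the model colimit Kummer maps (`kummerLim_spec` for `unitKummerTheoryTLG/TCG`) -/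

namespace ModelMLFGaloisData

variable (C : MLFClosure.{0}) (D : ModelMLFGaloisData C.k C.K)

/-- Restriction of the model `TLG` Kummer class along `J ≤ H` is the Kummer class at `J` (the `kummer_res` law of
Prop. 3.2 (ii), for the unit theory; abc-iut-L2-t3's `resH1_kummerClass`).
[cite: MochizukiAbsTopIII2015, Proposition 3.3 (i) p.73] -/
theorem unitKummerTheoryTLG_kummer_res {H J : OpenSubgroup D.tlgPair.Pi} (hJH : J ≤ H)
    (m : {m : D.tlgPair.M // ∀ h : H, (h : D.tlgPair.Pi) • m = m}) :
    (D.unitKummerTheoryTLG C).coh.res hJH ((D.unitKummerTheoryTLG C).kummer H m) =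
      (D.unitKummerTheoryTLG C).kummer J ⟨m.1, fun j => m.2 ⟨j.1, hJH j.2⟩⟩ := by
  rw [unitKummerTheoryTLG_kummer, unitKummerTheoryTLG_kummer]
  exact EtaleTheta.resH1_kummerClass (A := (C.K)ˣ) (G := D.Pi) (OpenSubgroup.toSubgroup_le.mpr hJH) _
    (D.tlgInvariantUnit C H m).2 (D.tlgInvariantUnit C J ⟨m.1, fun j => m.2 ⟨j.1, hJH j.2⟩⟩).2

/-- Restriction of the model `TCG` Kummer class along `J ≤ H` is the Kummer class at `J`.
[cite: MochizukiAbsTopIII2015, Proposition 3.3 (i) p.73] -/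
theorem unitKummerTheoryTCG_kummer_res {H J : OpenSubgroup D.tcgPair.Pi} (hJH : J ≤ H)
    (m : {m : D.tcgPair.M // ∀ h : H, (h : D.tcgPair.Pi) • m = m}) :
    (D.unitKummerTheoryTCG C).coh.res hJH ((D.unitKummerTheoryTCG C).kummer H m) =
      (D.unitKummerTheoryTCG C).kummer J ⟨m.1, fun j => m.2 ⟨j.1, hJH j.2⟩⟩ := by
  rw [unitKummerTheoryTCG_kummer, unitKummerTheoryTCG_kummer]
  exact EtaleTheta.resH1_kummerClass (A := (C.K)ˣ) (G := D.Pi) (OpenSubgroup.toSubgroup_le.mpr hJH) _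
    (D.tcgInvariantUnit C H m).2 (D.tcgInvariantUnit C J ⟨m.1, fun j => m.2 ⟨j.1, hJH j.2⟩⟩).2

/-- **`kummerLim_spec` for the model `TLG` unit theory**: the colimit Kummer class `kummerLim m ∈ lim→_J H¹(J, Λ(k̄ˣ))`
(defined at the open stabiliser of `m`) is represented at EVERY open `H ⊆ Π_k` fixing `m` by `κ_H(m)` — the two
representatives agree after restriction to `Stab(m) ⊓ H`. [cite: MochizukiAbsTopIII2015, Proposition 3.3 (i) p.73] -/
theorem unitKummerTheoryTLG_kummerLim_eq_mk (m : D.tlgPair.M) (H : OpenSubgroup D.tlgPair.Pi)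
    (hm : ∀ h : H, (h : D.tlgPair.Pi) • m = m) :
    (D.unitKummerTheoryTLG C).kummerLim m =
      Quot.mk _ ⟨H, (D.unitKummerTheoryTLG C).kummer H ⟨m, hm⟩⟩ := by
  obtain ⟨hs, hlim⟩ : ∃ hs : ∀ h : D.tlgStabilizerOpen C m, (h : D.tlgPair.Pi) • m = m,
      (D.unitKummerTheoryTLG C).kummerLim m =
        Quot.mk _ ⟨D.tlgStabilizerOpen C m, (D.unitKummerTheoryTLG C).kummer (D.tlgStabilizerOpen C m) ⟨m, hs⟩⟩ :=
    ⟨_, rfl⟩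
  rw [hlim]
  refine Quot.sound ⟨D.tlgStabilizerOpen C m ⊓ H, inf_le_left, inf_le_right, ?_⟩
  show (D.unitKummerTheoryTLG C).coh.res inf_le_left
      ((D.unitKummerTheoryTLG C).kummer (D.tlgStabilizerOpen C m) ⟨m, hs⟩) =
    (D.unitKummerTheoryTLG C).coh.res inf_le_right ((D.unitKummerTheoryTLG C).kummer H ⟨m, hm⟩)
  rw [unitKummerTheoryTLG_kummer_res, unitKummerTheoryTLG_kummer_res]

/-- **`kummerLim_spec` for the model `TCG` unit theory.** [cite: MochizukiAbsTopIII2015, Proposition 3.3 (i) p.73] -/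
theorem unitKummerTheoryTCG_kummerLim_eq_mk (m : D.tcgPair.M) (H : OpenSubgroup D.tcgPair.Pi)
    (hm : ∀ h : H, (h : D.tcgPair.Pi) • m = m) :
    (D.unitKummerTheoryTCG C).kummerLim m =
      Quot.mk _ ⟨H, (D.unitKummerTheoryTCG C).kummer H ⟨m, hm⟩⟩ := by
  obtain ⟨hs, hlim⟩ : ∃ hs : ∀ h : D.tcgStabilizerOpen C m, (h : D.tcgPair.Pi) • m = m,
      (D.unitKummerTheoryTCG C).kummerLim m =
        Quot.mk _ ⟨D.tcgStabilizerOpen C m, (D.unitKummerTheoryTCG C).kummer (D.tcgStabilizerOpen C m) ⟨m, hs⟩⟩ :=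
    ⟨_, rfl⟩
  rw [hlim]
  refine Quot.sound ⟨D.tcgStabilizerOpen C m ⊓ H, inf_le_left, inf_le_right, ?_⟩
  show (D.unitKummerTheoryTCG C).coh.res inf_le_left
      ((D.unitKummerTheoryTCG C).kummer (D.tcgStabilizerOpen C m) ⟨m, hs⟩) =
    (D.unitKummerTheoryTCG C).coh.res inf_le_right ((D.unitKummerTheoryTCG C).kummer H ⟨m, hm⟩)
  rw [unitKummerTheoryTCG_kummer_res, unitKummerTheoryTCG_kummer_res]

/-- In the GROUP-structured direct limit `lim→_J H¹(J, Λ(k̄ˣ))` (`ContCohomologyData.H1LimGrp`, Mathlib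
`AddCommGroup.DirectLimit`), the model `TLG` colimit Kummer class of `m` is `ofGrp H (κ_H m)` for every open `H`
fixing `m`. [cite: MochizukiAbsTopIII2015, Proposition 3.3 (i) p.73] -/
theorem unitKummerTheoryTLG_toGrp_kummerLim (m : D.tlgPair.M) (H : OpenSubgroup D.tlgPair.Pi)
    (hm : ∀ h : H, (h : D.tlgPair.Pi) • m = m) :
    (D.unitKummerTheoryTLG C).coh.toGrp ((D.unitKummerTheoryTLG C).kummerLim m) =
      (D.unitKummerTheoryTLG C).coh.ofGrp H ((D.unitKummerTheoryTLG C).kummer H ⟨m, hm⟩) := by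
  rw [D.unitKummerTheoryTLG_kummerLim_eq_mk C m H hm]
  rfl

/-- The same for the model `TCG` unit theory. [cite: MochizukiAbsTopIII2015, Proposition 3.3 (i) p.73] -/
theorem unitKummerTheoryTCG_toGrp_kummerLim (m : D.tcgPair.M) (H : OpenSubgroup D.tcgPair.Pi)
    (hm : ∀ h : H, (h : D.tcgPair.Pi) • m = m) :
    (D.unitKummerTheoryTCG C).coh.toGrp ((D.unitKummerTheoryTCG C).kummerLim m) =
      (D.unitKummerTheoryTCG C).coh.ofGrp H ((D.unitKummerTheoryTCG C).kummer H ⟨m, hm⟩) := by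
  rw [D.unitKummerTheoryTCG_kummerLim_eq_mk C m H hm]
  rfl

end ModelMLFGaloisData

/-! ## §2 Naturality of the colimit Kummer maps along general morphisms, at compatible levels -/

namespace GaloisMonoidPair.Hom

variable {C₁ C₂ : MLFClosure.{0}} {D₁ : ModelMLFGaloisData C₁.k C₁.K} {D₂ : ModelMLFGaloisData C₂.k C₂.K}

/-- **Compatible levels exist**: for a morphism `φ = (φ_Π, φ_M)` of pairs `(Π₁ ↷ M₁) → (Π₂ ↷ M₂)` with open point
stabilisers and `m₁ ∈ M₁`, the open levels `H₂ := Stab(φ_M m₁)`, `H₁ := Stab(m₁) ⊓ φ_Π⁻¹(H₂)` satisfy `φ_Π(H₁) ≤ H₂`,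
`H₁` fixes `m₁`, `H₂` fixes `φ_M m₁`. [cite: MochizukiAbsTopIII2015, Definition 3.1 (ii) p.67] -/
theorem exists_compatible_levels {P Q : GaloisMonoidPair.{0}} (φ : GaloisMonoidPair.Hom P Q) (m₁ : P.M) :
    ∃ (H₁ : OpenSubgroup P.Pi) (H₂ : OpenSubgroup Q.Pi),
      (H₁ : Subgroup P.Pi).map φ.homPi ≤ (H₂ : Subgroup Q.Pi) ∧
        (∀ h : H₁, (h : P.Pi) • m₁ = m₁) ∧ ∀ h : H₂, (h : Q.Pi) • φ.homM m₁ = φ.homM m₁ := by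
  refine ⟨P.stabilizerOpen m₁ ⊓ (Q.stabilizerOpen (φ.homM m₁)).comap φ.homPi φ.continuous_homPi,
    Q.stabilizerOpen (φ.homM m₁), ?_, fun h => (P.mem_stabilizerOpen_iff m₁ h).mp (inf_le_left (b :=
      ((Q.stabilizerOpen (φ.homM m₁)).comap φ.homPi φ.continuous_homPi)) h.2),
    fun h => (Q.mem_stabilizerOpen_iff (φ.homM m₁) h).mp h.2⟩
  rintro _ ⟨g, hg, rfl⟩
  exact OpenSubgroup.mem_comap.mp ((inf_le_right (a := P.stabilizerOpen m₁)) hg)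

/-- **Naturality of the COLIMIT unit Kummer maps of the model `TLG`-pairs along a general morphism, at compatible levels.**
For a Def. 3.1 (ii) morphism `φ : (Π_{k₁} ↷ k̄₁^×) → (Π_{k₂} ↷ k̄₂^×)`, `m₁ ∈ k̄₁^×`, and ANY compatible open levels
`H₁`, `H₂` (`φ_Π(H₁) ≤ H₂`, `H₁` fixes `m₁`, `H₂` fixes `φ_M m₁` — e.g. those of `exists_compatible_levels`): the colimit
classes `kummerLim₂(φ_M m₁) ∈ lim→ H¹(·, Λ(k̄₂ˣ))` and `kummerLim₁(m₁) ∈ lim→ H¹(·, Λ(k̄₁ˣ))` of t2's `unitKummerTheoryTLG` are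
represented at `H₂`, resp. `H₁`, by the level classes `κ_{H₂}(φ_M m₁)`, `κ_{H₁}(m₁)`, AND these satisfy
`φ_Π^* κ_{H₂}(φ_M m₁) = Λ(φ_M)_* κ_{H₁}(m₁)` in `H¹(H₁, res_{φ_Π} Λ(k̄₂ˣ))` (`tlgUnitsMorphism_pullH1_kummer`, p429893).
[cite: MochizukiAbsTopIII2015, Proposition 3.3 (i) p.73] -/
theorem tlg_kummerLim_natural (φ : GaloisMonoidPair.Hom D₁.tlgPair D₂.tlgPair) (m₁ : D₁.tlgPair.M)
    {H₁ : OpenSubgroup D₁.tlgPair.Pi} {H₂ : OpenSubgroup D₂.tlgPair.Pi}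
    (hH : (H₁ : Subgroup D₁.Pi).map φ.homPi ≤ (H₂ : Subgroup D₂.Pi))
    (hm₁ : ∀ h : H₁, (h : D₁.tlgPair.Pi) • m₁ = m₁) (hm₂ : ∀ h : H₂, (h : D₂.tlgPair.Pi) • φ.homM m₁ = φ.homM m₁) :
    (D₂.unitKummerTheoryTLG C₂).kummerLim (φ.homM m₁) =
        Quot.mk _ ⟨H₂, (D₂.unitKummerTheoryTLG C₂).kummer H₂ ⟨φ.homM m₁, hm₂⟩⟩ ∧
      (D₁.unitKummerTheoryTLG C₁).kummerLim m₁ =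
        Quot.mk _ ⟨H₁, (D₁.unitKummerTheoryTLG C₁).kummer H₁ ⟨m₁, hm₁⟩⟩ ∧
      (⟨φ.homPi, nonZeroDivisorsEquivUnits.toMonoidHom.comp
            (φ.homM.comp (nonZeroDivisorsEquivUnits (G₀ := C₁.K)).symm.toMonoidHom),
          ModelMLFGaloisData.tlgHom_unitsMap_smul C₁ C₂ D₁ D₂ φ⟩ :
          EquivariantMorphism D₁.Pi (C₁.K)ˣ D₂.Pi (C₂.K)ˣ).pullH1 hH
          ((D₂.unitKummerTheoryTLG C₂).kummer H₂ ⟨φ.homM m₁, hm₂⟩) =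
        (⟨φ.homPi, nonZeroDivisorsEquivUnits.toMonoidHom.comp
            (φ.homM.comp (nonZeroDivisorsEquivUnits (G₀ := C₁.K)).symm.toMonoidHom),
          ModelMLFGaloisData.tlgHom_unitsMap_smul C₁ C₂ D₁ D₂ φ⟩ :
          EquivariantMorphism D₁.Pi (C₁.K)ˣ D₂.Pi (C₂.K)ˣ).pushH1 hH
          ((D₁.unitKummerTheoryTLG C₁).kummer H₁ ⟨m₁, hm₁⟩) :=
  ⟨D₂.unitKummerTheoryTLG_kummerLim_eq_mk C₂ (φ.homM m₁) H₂ hm₂,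
    D₁.unitKummerTheoryTLG_kummerLim_eq_mk C₁ m₁ H₁ hm₁,
    φ.tlgUnitsMorphism_pullH1_kummer hH ⟨m₁, hm₁⟩ ⟨φ.homM m₁, hm₂⟩ rfl⟩

/-- **Naturality of the COLIMIT unit Kummer maps of the model `TCG`-pairs along a general morphism, at compatible
levels, INTRINSIC coefficients** `Λ((𝒪_k̄^×)ˣ)` (p430251): for a Def. 3.1 (ii) morphism `φ` of the model `TCG`-pairs, a unit
`u₁` of `𝒪_{k̄₁}^×` and compatible open levels `H₁`, `H₂` fixing `u₁`, resp. `(φ_M)ˣ u₁`: the colimit classes of t2's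
`unitKummerTheoryTCG` at `(φ_M)ˣ u₁` and `u₁` are represented at `H₂`, `H₁` by t2's level classes, these are the
push-forwards along `Λ((𝒪^×)ˣ ↪ k̄ˣ)` of the intrinsic classes (comparison squares,
`unitKummerTheoryTCG_kummer_eq_push_intrinsic`), and the intrinsic classes satisfy
`φ_Π^* κ_{H₂}((φ_M)ˣ u₁) = Λ((φ_M)ˣ)_* κ_{H₁}(u₁)` (`tcgIntrinsic_pullH1_kummerClass`).
[cite: MochizukiAbsTopIII2015, Proposition 3.3 (i) p.73] -/
theorem tcg_kummerLim_natural (φ : GaloisMonoidPair.Hom D₁.tcgPair D₂.tcgPair)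
    (u₁ : (unitSubmonoid C₁.k C₁.K)ˣ) {H₁ : OpenSubgroup D₁.tcgPair.Pi} {H₂ : OpenSubgroup D₂.tcgPair.Pi}
    (hH : (H₁ : Subgroup D₁.Pi).map φ.homPi ≤ (H₂ : Subgroup D₂.Pi))
    (hu₁ : ∀ h : H₁, (h : D₁.Pi) • u₁ = u₁) (hu₂ : ∀ h : H₂, (h : D₂.Pi) • Units.map φ.homM u₁ = Units.map φ.homM u₁) :
    (D₂.unitKummerTheoryTCG C₂).kummerLim ((Units.map φ.homM u₁ : (unitSubmonoid C₂.k C₂.K)ˣ) : unitSubmonoid C₂.k C₂.K) =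
        Quot.mk _ ⟨H₂, (D₂.unitKummerTheoryTCG C₂).kummer H₂
          ⟨((Units.map φ.homM u₁ : (unitSubmonoid C₂.k C₂.K)ˣ) : unitSubmonoid C₂.k C₂.K),
            fun h => congrArg Units.val (hu₂ h)⟩⟩ ∧
      (D₁.unitKummerTheoryTCG C₁).kummerLim ((u₁ : (unitSubmonoid C₁.k C₁.K)ˣ) : unitSubmonoid C₁.k C₁.K) =
        Quot.mk _ ⟨H₁, (D₁.unitKummerTheoryTCG C₁).kummer H₁
          ⟨((u₁ : (unitSubmonoid C₁.k C₁.K)ˣ) : unitSubmonoid C₁.k C₁.K), fun h => congrArg Units.val (hu₁ h)⟩⟩ ∧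
      (⟨φ.homPi, Units.map φ.homM, φ.unitsMap_homM_smul⟩ :
          EquivariantMorphism D₁.Pi (unitSubmonoid C₁.k C₁.K)ˣ D₂.Pi (unitSubmonoid C₂.k C₂.K)ˣ).pullH1 hH
          (kummerClass (H₂ : Subgroup D₂.Pi)
            (⟨Units.map φ.homM u₁, hu₂⟩ : invariants (A := (unitSubmonoid C₂.k C₂.K)ˣ) (H₂ : Subgroup D₂.Pi))) =
        (⟨φ.homPi, Units.map φ.homM, φ.unitsMap_homM_smul⟩ :
          EquivariantMorphism D₁.Pi (unitSubmonoid C₁.k C₁.K)ˣ D₂.Pi (unitSubmonoid C₂.k C₂.K)ˣ).pushH1 hH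
          (kummerClass (H₁ : Subgroup D₁.Pi)
            (⟨u₁, hu₁⟩ : invariants (A := (unitSubmonoid C₁.k C₁.K)ˣ) (H₁ : Subgroup D₁.Pi))) :=
  ⟨D₂.unitKummerTheoryTCG_kummerLim_eq_mk C₂ _ H₂ _, D₁.unitKummerTheoryTCG_kummerLim_eq_mk C₁ _ H₁ _,
    φ.tcgIntrinsic_pullH1_kummerClass hH ⟨u₁, hu₁⟩ ⟨Units.map φ.homM u₁, hu₂⟩ rfl⟩

end GaloisMonoidPair.Hom

end Literature.AnabelianGeometry.AbsoluteAnabelian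

end
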